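import Summits.ABC.ABC.Theses.CubicResolventAllowance
import Literature.NumberTheory.EllipticCurves.MordellCurveThreeDescent
import HarnessLib

/-!
# stub-ideation k2 (RESHAPE) — generation 15 sketch for `stub_complexCubic` (crux `IndexSzpiro`, stmt-ABC-22740)

Companion to `STUB-IDEAS-stub_complexCubic-2.md` (gen 15).  Gens 2–14 of this slot stand BY REFERENCE
(`StubIdeas2G*Sketch.lean`, same directory).  This file types ONLY what gen 15 adds — the two RESHAPE cells in
which the sign hypothesis `d_K < 0` changes the ALGEBRA (not just the archimedean picture):

* §A  MORDELL / 3-DESCENT CURRENCY.  `W ↦ P_W = (c₄, c₆)`, a rational (integral for an integral model) point of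
  the Mordell curve `E_D : y² = x³ + D`, `D = c₆² − c₄³ = −1728·Δ(W)` (A1, proved); the complex class is exactly
  `D > 0`, i.e. the `√D`-descent field `M = ℚ(√D) = ℚ(√(−3Δ))` is REAL quadratic (A2, proved modulo the banked
  identity `Δ = q²·d_K`); and the crux hypothesis `r(W) = 0` (`ψ₂(W)` irreducible) is the statement that the
  Cardano/Kummer element `γ_W = c₆ + √D` is NOT a cube in `M` (A3, M-sized, sorried) — the `φ`-descent image of
  `P_W` is non-trivial.  Tools this form admits: `φ`-Selmer/rank bounds through `Cl(M)[3]` and the unit of `M`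
  (Brumer–Silverman, Helfgott–Venkatesh 2006 §4.2) — they COUNT curves, they do not bound `Δ_min`; integral-point
  SIZE bounds on `E_D` are Baker/Hall currency.  See the .md, §1-A.
* §B  UNIT ALLOWANCE.  Artin's inequality `|d_K| < 4η³ + 24` for complex cubic fields (B0, a named hypothesis;
  Fröhlich–Taylor (3.2) p.181) turns the stub into the WEAKER `UnitSzpiro` (allowance `e^{3 R_K}`; B1/B2, proved):
  the only sign-using weakening, and it carries no information about `Δ_min` (see the .md, §1-B).

Nothing here is an arrow TOWARD the stub; A1–A3 are dictionary lemmas (bank value for counting/descent lines),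
B1–B2 a calibration (do not staff).
-/

open Polynomial
open scoped NumberField
open Literature.NumberTheory.EllipticCurves (mordellCurve mordellCurve_equation_iff)

set_option linter.dupNamespace false

namespace Summit.ABC.ABC.Cruxes.IndexSzpiro.StubIdeas2G15

/-! ## §0  The stub (verbatim) -/

/-- `stub_complexCubic`, verbatim (registered signature, skeleton sha d34fb8f2…). -/
def Stub : Prop :=
  ∀ ε : ℝ, 0 < ε → ∃ C : ℝ, ∀ (W : WeierstrassCurve ℚ) [W.IsElliptic] (K : Type) [Field K] [NumberField K],
    Irreducible W.twoTorsionPolynomial.toPoly → Module.finrank ℚ K = 3 →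
    (∃ θ : K, aeval θ W.twoTorsionPolynomial.toPoly = 0) → NumberField.discr K < 0 →
    (W.minimalDiscriminantNorm ℤ : ℝ) ≤ C * |(NumberField.discr K : ℝ)| * (W.conductorNorm ℤ : ℝ) ^ (6 + ε)

/-! ## §A  Mordell / 3-descent currency -/

/-- **A1 (S, proved).** `P_W = (c₄, c₆)` lies on the Mordell curve `y² = x³ + D` with `D = −1728·Δ(W)`
(`c_relation : 1728Δ = c₄³ − c₆²`), over any commutative ring — for an integral model an INTEGRAL point.
[folklore; Brumer–Silverman 1996, Helfgott–Venkatesh 2006 Lemma 4.4] -/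
theorem cPoint_equation {R : Type*} [CommRing R] (W : WeierstrassCurve R) :
    (mordellCurve (-1728 * W.Δ)).toAffine.Equation W.c₄ W.c₆ := by
  rw [mordellCurve_equation_iff]
  linear_combination W.c_relation

/-- **A2 (S, proved mod the banked identity).** THE SIGN DOOR IN MORDELL CURRENCY: with `Δ(W) = q²·d_K`
(k3 H1 / k1-G5 `discSqRatio`, kernel-checked in `StubIdeas1G5Sketch.lean`, taken as a binder) the complex
hypothesis `d_K < 0` is `0 < D = c₆² − c₄³`, i.e. the `√D`-descent field `ℚ(√D) = ℚ(√(−3Δ))` of the Mordell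
curve of A1 is REAL quadratic (unit rank 1) — resp. imaginary on the real class. [folklore] -/
theorem discr_neg_iff_cardanoParam_pos (W : WeierstrassCurve ℚ) (K : Type) [Field K] [NumberField K]
    {q : ℚ} (hq : q ≠ 0) (hΔ : W.Δ = q ^ 2 * (NumberField.discr K : ℚ)) :
    NumberField.discr K < 0 ↔ 0 < W.c₆ ^ 2 - W.c₄ ^ 3 := by
  have hq2 : 0 < q ^ 2 := by positivity
  have h : W.c₆ ^ 2 - W.c₄ ^ 3 = -1728 * (q ^ 2 * (NumberField.discr K : ℚ)) := by
    rw [← hΔ]; linear_combination W.c_relation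
  rw [h]
  constructor
  · intro hd
    have hd' : (NumberField.discr K : ℚ) < 0 := by exact_mod_cast hd
    nlinarith [mul_neg_of_pos_of_neg hq2 hd']
  · intro h0
    have : (NumberField.discr K : ℚ) < 0 := by
      by_contra hcon
      have hcon' : 0 ≤ (NumberField.discr K : ℚ) := not_lt.mp hcon
      nlinarith [mul_nonneg hq2.le hcon']
    exact_mod_cast this

/-- **A3 (M, sorried) — CARDANO CRITERION.** If `D = c₆² − c₄³` is not a rational square and `M ∋ s`,
`s² = D`, is the quadratic field `ℚ(√D)`, then the 2-division cubic of `W` has a rational root iff the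
Cardano element `γ_W = c₆ + s` is a cube in `M`.  (Substituting `X = 36x + 3b₂` turns `ψ₂` into
`X³ − 27c₄X − 54c₆`; Cardano: `X = u + v`, `u³, v³ = 27(c₆ ± s)`, `uv = 9c₄`; a rational root `e` gives
`u ∈ ℚ(√(e² − 36c₄)) = M` with `(u/3)³ = γ_W`, conversely `γ_W = β³` gives the root `3·Tr_{M/ℚ} β`.)  Hence on
the class of the crux (`r(W) = 0`) the `φ`-Kummer image `γ_W ∈ M^×/M^{×3}` of `P_W` (A1) is non-trivial.
[folklore: Cardano; HelfgottVenkatesh2006 §4.2 for the descent dictionary] -/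
theorem ratRoot_iff_cardano_cube (W : WeierstrassCurve ℚ) [W.IsElliptic]
    (M : Type) [Field M] [NumberField M] (hM : Module.finrank ℚ M = 2)
    (s : M) (hs : s ^ 2 = algebraMap ℚ M (W.c₆ ^ 2 - W.c₄ ^ 3)) (hirr : ∀ q : ℚ, s ≠ algebraMap ℚ M q) :
    (∃ e : ℚ, W.twoTorsionPolynomial.toPoly.IsRoot e) ↔ ∃ β : M, β ^ 3 = algebraMap ℚ M W.c₆ + s := by
  sorry

/-- **A3′ (S, corollary of A3; sorried only through A3).** On the crux's class the Cardano element is a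
non-cube of `M`. -/
theorem cardano_not_cube_of_irreducible (W : WeierstrassCurve ℚ) [W.IsElliptic]
    (hW : Irreducible W.twoTorsionPolynomial.toPoly)
    (M : Type) [Field M] [NumberField M] (hM : Module.finrank ℚ M = 2)
    (s : M) (hs : s ^ 2 = algebraMap ℚ M (W.c₆ ^ 2 - W.c₄ ^ 3)) (hirr : ∀ q : ℚ, s ≠ algebraMap ℚ M q) :
    ∀ β : M, β ^ 3 ≠ algebraMap ℚ M W.c₆ + s := by
  intro β hβ
  have hroot : ∃ e : ℚ, W.twoTorsionPolynomial.toPoly.IsRoot e :=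
    (ratRoot_iff_cardano_cube W M hM s hs hirr).mpr ⟨β, hβ⟩
  obtain ⟨e, he⟩ := hroot
  have hdeg := Polynomial.degree_eq_one_of_irreducible_of_root hW he
  have h3 : W.twoTorsionPolynomial.toPoly.degree = 3 :=
    Cubic.degree_of_a_ne_zero (by norm_num [WeierstrassCurve.twoTorsionPolynomial])
  rw [h3] at hdeg
  exact absurd hdeg (by decide)

/-! ## §B  The unit allowance (the only sign-using weakening) -/

/-- **B0 (named hypothesis; Literature-fact candidate).** ARTIN'S INEQUALITY: a complex cubic field (`d_K < 0`,
unit rank 1, regulator `R_K = log η` for the fundamental unit `η > 1` of the real embedding) has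
`|d_K| < 4η³ + 24 = 4e^{3R_K} + 24`. [cite: book:frohlich1990-algebraic-number-theory, (3.2) p.181] -/
def ArtinUnitIneq : Prop :=
  ∀ (K : Type) [Field K] [NumberField K], Module.finrank ℚ K = 3 → NumberField.discr K < 0 →
    |(NumberField.discr K : ℝ)| < 4 * Real.exp (3 * NumberField.Units.regulator K) + 24

/-- **B1.** `UnitSzpiro`: the stub with the resolvent-discriminant allowance replaced by the cube of the
fundamental unit of the complex cubic field, `e^{3R_K}`.  A WEAKENING of the stub (B2); by Brauer–Siegel
`e^{R_K} ≥ exp(|d_K|^{1/2−ε}/h_K)`, so it is nearly void (see the .md §1-B) — calibration, do not staff. -/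
def UnitSzpiro : Prop :=
  ∀ ε : ℝ, 0 < ε → ∃ C : ℝ, ∀ (W : WeierstrassCurve ℚ) [W.IsElliptic] (K : Type) [Field K] [NumberField K],
    Irreducible W.twoTorsionPolynomial.toPoly → Module.finrank ℚ K = 3 →
    (∃ θ : K, aeval θ W.twoTorsionPolynomial.toPoly = 0) → NumberField.discr K < 0 →
    (W.minimalDiscriminantNorm ℤ : ℝ) ≤
      C * Real.exp (3 * NumberField.Units.regulator K) * (W.conductorNorm ℤ : ℝ) ^ (6 + ε)

/-- **B2 (S, proved).** `Stub ⇒ UnitSzpiro` under Artin's inequality: the sign hypothesis buys a forced unit of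
size `≥ ((|d_K| − 24)/4)^{1/3}`, and nothing flows back to `Δ_min`. -/
theorem unitSzpiro_of_stub (hA : ArtinUnitIneq) (h : Stub) : UnitSzpiro := by
  intro ε hε
  obtain ⟨C, hC⟩ := h ε hε
  refine ⟨max C 0 * 28, ?_⟩
  intro W _ K _ _ hirr hK hθ hd
  have h1 := hC W K hirr hK hθ hd
  have hA' := hA K hK hd
  have hexp : 1 ≤ Real.exp (3 * NumberField.Units.regulator K) :=
    Real.one_le_exp (by positivity [NumberField.Units.regulator_pos K])
  have hdle : |(NumberField.discr K : ℝ)| ≤ 28 * Real.exp (3 * NumberField.Units.regulator K) := by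
    linarith
  have hN : 0 ≤ (W.conductorNorm ℤ : ℝ) ^ (6 + ε) := by positivity
  have hC0 : C ≤ max C 0 := le_max_left _ _
  have hM0 : 0 ≤ max C 0 := le_max_right _ _
  calc (W.minimalDiscriminantNorm ℤ : ℝ)
      ≤ C * |(NumberField.discr K : ℝ)| * (W.conductorNorm ℤ : ℝ) ^ (6 + ε) := h1
    _ ≤ max C 0 * |(NumberField.discr K : ℝ)| * (W.conductorNorm ℤ : ℝ) ^ (6 + ε) := by
        gcongr
    _ ≤ max C 0 * (28 * Real.exp (3 * NumberField.Units.regulator K)) * (W.conductorNorm ℤ : ℝ) ^ (6 + ε) := by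
        gcongr
    _ = max C 0 * 28 * Real.exp (3 * NumberField.Units.regulator K) * (W.conductorNorm ℤ : ℝ) ^ (6 + ε) := by
        ring

end Summit.ABC.ABC.Cruxes.IndexSzpiro.StubIdeas2G15
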